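import Mathlib
import Literature.AlgebraicGeometry.Resolution.WeightedQuasiRegularGeneral
import HarnessLib

/-!
# Weighted order ideals under the coordinate changes of the polyhedron game

Topic: `Literature/AlgebraicGeometry/Resolution`. Two invariance statements for the weighted
order ideals `F^{W}_ρ(c)` (`WeightedQuasiRegularGeneral.weightedIdealW`, `c = (z, u₁, u₂)`) under the
coordinate changes occurring in the proof of Cossart–Piltant 2008, Lemma 4.5 (p. 12: "we replace
`(u₁, u₂, z)` by `(u₁, v₂ := u₂ + λu₁, z)`. By (14) and definition of vertex solvability, we have
`v := (α, β)` [unchanged]"; and the vertex dissolutions `z ↦ z + λ u₁^{v₁} u₂^{v₂}` of the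
preparation procedure, p. 11): 

* `weightedIdealW_shift_u₂` — **`F^{W}_ρ(z, u₁, u₂ + λu₁) = F^{W}_ρ(z, u₁, u₂)` when `W₁ ≥ W₂`**
  (the supporting lines steeper than the diagonal do not see the shear `u₂ ↦ u₂ + λu₁`);
* `weightedIdealW_shift_z` — **`F^{W}_ρ(z + t, u₁, u₂) = F^{W}_ρ(z, u₁, u₂)` for `t ∈ F^{W}_{W₀}`**
  (e.g. `t = λ u₁^{a} u₂^{b}` with `a W₁ + b W₂ ≥ W₀`: dissolving a vertex on or above the
  supporting line does not change the functional).

Both follow from `F_ρ · F_σ ⊆ F_{ρ+σ}` by expanding the binomials.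

## Sources

* V. Cossart, O. Piltant, J. Algebra 320 (2008), proof of Lemma 4.5, pp. 11–12. [CossartPiltant2008]
* H. Hironaka, *Characteristic polyhedra of singularities*, J. Math. Kyoto Univ. 7 (1967). [Hironaka1967]
-/

noncomputable section

open IsLocalRing

namespace Literature.AlgebraicGeometry.Resolution

universe u

variable {R : Type u} [CommRing R]

/-- A single coordinate has the expected weight: `c_i ∈ F_{W_i}`. [folklore] -/
theorem apply_mem_weightedIdealW (c : Fin 3 → R) (W : Fin 3 → ℕ) (i : Fin 3) :
    c i ∈ weightedIdealW c W (W i) := by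
  have : c i = monom3 c (Finsupp.single i 1) := by
    fin_cases i <;> simp [monom3]
  rw [this]
  refine monomial_mem_weightedIdealW c W ?_
  rw [Finsupp.weight_apply, Finsupp.sum_single_index (by simp), smul_eq_mul, one_mul]

/-- Powers: `x ∈ F_σ ⇒ x^n ∈ F_{nσ}`. [folklore] -/
theorem pow_mem_weightedIdealW (c : Fin 3 → R) (W : Fin 3 → ℕ) {x : R} {σ : ℕ}
    (hx : x ∈ weightedIdealW c W σ) (n : ℕ) : x ^ n ∈ weightedIdealW c W (n * σ) := by
  induction n with
  | zero =>
    rw [pow_zero, Nat.zero_mul]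
    have h1 : (1 : R) ∈ weightedIdealW c W 0 := by
      have := monomial_mem_weightedIdealW c W (ρ := 0) (e := 0) (by simp)
      simpa [monom3] using this
    exact h1
  | succ n ih =>
    rw [pow_succ, Nat.succ_mul]
    exact weightedIdealW_mul_le c W _ _ (Ideal.mul_mem_mul ih hx)

/-- **A family all of whose members lie in the right weighted ideals generates no more**: if
`c′_i ∈ F^{W}_{W_i}(c)` for all `i`, then `F^{W}_ρ(c′) ⊆ F^{W}_ρ(c)` for all `ρ`. [folklore] -/
theorem weightedIdealW_le_of_forall_apply_mem (c c' : Fin 3 → R) (W : Fin 3 → ℕ)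
    (h : ∀ i, c' i ∈ weightedIdealW c W (W i)) (ρ : ℕ) :
    weightedIdealW c' W ρ ≤ weightedIdealW c W ρ := by
  refine Ideal.span_le.mpr ?_
  rintro _ ⟨e, he, rfl⟩
  have hmem : monom3 c' e ∈ weightedIdealW c W (Finsupp.weight W e) := by
    have hwt : Finsupp.weight W e = e 0 * W 0 + e 1 * W 1 + e 2 * W 2 := by
      rw [Finsupp.weight_apply, Finsupp.sum_fintype _ _ (by simp)]
      simp [Fin.sum_univ_three]
    rw [hwt, monom3]
    refine weightedIdealW_mul_le c W _ _ (Ideal.mul_mem_mul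
      (weightedIdealW_mul_le c W _ _ (Ideal.mul_mem_mul ?_ ?_)) ?_)
    · exact pow_mem_weightedIdealW c W (h 0) _
    · exact pow_mem_weightedIdealW c W (h 1) _
    · exact pow_mem_weightedIdealW c W (h 2) _
  exact weightedIdealW_antitone c W he hmem

/-- **Shear invariance**: `F^{W}_ρ(z, u₁, u₂ + λu₁) = F^{W}_ρ(z, u₁, u₂)` when `W₁ ≥ W₂`.
[cite: CossartPiltant2008, proof of Lemma 4.5, p. 12] -/
theorem weightedIdealW_shift_u₂ (z u₁ u₂ lam : R) (W : Fin 3 → ℕ) (hW : W 2 ≤ W 1) (ρ : ℕ) :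
    weightedIdealW ![z, u₁, u₂ + lam * u₁] W ρ = weightedIdealW ![z, u₁, u₂] W ρ := by
  have key : ∀ (u₂ lam : R), weightedIdealW ![z, u₁, u₂ + lam * u₁] W ρ ≤
      weightedIdealW ![z, u₁, u₂] W ρ := by
    intro u₂ lam
    refine weightedIdealW_le_of_forall_apply_mem _ _ W (fun i => ?_) ρ
    fin_cases i
    · exact apply_mem_weightedIdealW ![z, u₁, u₂] W 0
    · exact apply_mem_weightedIdealW ![z, u₁, u₂] W 1
    · change u₂ + lam * u₁ ∈ weightedIdealW ![z, u₁, u₂] W (W 2)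
      refine Ideal.add_mem _ (apply_mem_weightedIdealW ![z, u₁, u₂] W 2)
        (Ideal.mul_mem_left _ _ ?_)
      exact weightedIdealW_antitone _ W hW (apply_mem_weightedIdealW ![z, u₁, u₂] W 1)
  refine le_antisymm (key u₂ lam) ?_
  have h := key (u₂ + lam * u₁) (-lam)
  have : u₂ + lam * u₁ + -lam * u₁ = u₂ := by ring
  rwa [this] at h

/-- **Vertex-dissolution invariance**: `F^{W}_ρ(z + t, u₁, u₂) = F^{W}_ρ(z, u₁, u₂)` for
`t ∈ F^{W}_{W₀}(z, u₁, u₂)` not involving… (any `t` of weight `≥ W₀`, e.g. `λ u₁^{a} u₂^{b}` with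
`aW₁ + bW₂ ≥ W₀`). [cite: CossartPiltant2008, proof of Lemma 4.5, p. 11 (preparation)] -/
theorem weightedIdealW_shift_z (z u₁ u₂ t : R) (W : Fin 3 → ℕ)
    (ht : t ∈ weightedIdealW ![z, u₁, u₂] W (W 0))
    (ht' : t ∈ weightedIdealW ![z + t, u₁, u₂] W (W 0)) (ρ : ℕ) :
    weightedIdealW ![z + t, u₁, u₂] W ρ = weightedIdealW ![z, u₁, u₂] W ρ := by
  apply le_antisymm
  · refine weightedIdealW_le_of_forall_apply_mem _ _ W (fun i => ?_) ρ
    fin_cases i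
    · change z + t ∈ _
      exact Ideal.add_mem _ (apply_mem_weightedIdealW ![z, u₁, u₂] W 0) ht
    · exact apply_mem_weightedIdealW ![z, u₁, u₂] W 1
    · exact apply_mem_weightedIdealW ![z, u₁, u₂] W 2
  · refine weightedIdealW_le_of_forall_apply_mem _ _ W (fun i => ?_) ρ
    fin_cases i
    · change z ∈ weightedIdealW ![z + t, u₁, u₂] W (W 0)
      have hzt : z + t ∈ weightedIdealW ![z + t, u₁, u₂] W (W 0) :=
        apply_mem_weightedIdealW ![z + t, u₁, u₂] W 0
      have := Ideal.sub_mem _ hzt ht'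
      rwa [add_sub_cancel_right] at this
    · exact apply_mem_weightedIdealW ![z + t, u₁, u₂] W 1
    · exact apply_mem_weightedIdealW ![z + t, u₁, u₂] W 2

/-- The typical dissolution `t = λ u₁^{a} u₂^{b}` with `a W₁ + b W₂ ≥ W₀` satisfies both
hypotheses of `weightedIdealW_shift_z` (it does not involve `z`). [folklore] -/
theorem monomial_u_mem_weightedIdealW (z z' u₁ u₂ lam : R) (W : Fin 3 → ℕ) {a b : ℕ}
    (h : W 0 ≤ a * W 1 + b * W 2) :
    lam * (u₁ ^ a * u₂ ^ b) ∈ weightedIdealW ![z', u₁, u₂] W (W 0) ∧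
      lam * (u₁ ^ a * u₂ ^ b) ∈ weightedIdealW ![z, u₁, u₂] W (W 0) := by
  have key : ∀ w : R, lam * (u₁ ^ a * u₂ ^ b) ∈ weightedIdealW ![w, u₁, u₂] W (W 0) := by
    intro w
    refine Ideal.mul_mem_left _ _ ?_
    have : u₁ ^ a * u₂ ^ b = monom3 ![w, u₁, u₂] (Finsupp.equivFunOnFinite.symm ![0, a, b]) := by
      simp [monom3]
    rw [this]
    refine monomial_mem_weightedIdealW _ W ?_
    rw [Finsupp.weight_apply, Finsupp.sum_fintype _ _ (by simp)]
    simpa [Fin.sum_univ_three] using h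
  exact ⟨key z', key z⟩

end Literature.AlgebraicGeometry.Resolution

end
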